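import Summits.QuantumFields.YangMills.Theorems.BalabanUVNodesN15FullPropagatorSizedLive
import Summits.QuantumFields.YangMills.Theorems.BalabanUVNodesN15VectorPieceBackground

/-!
# Route «BalabanUVNodes», cluster K4 «SpineRates» — node N15 = NE2, -a lane, part 85 (programme S, file S-D): THE SIZED KNIT SOCKET — for ANY paired-instance family
# whose coarse carrier is n15-b's `opGeo` over a SIZE-LIVE unit torus (`{ unitTorusGeo … with M := M_i }`), ANY arguments∕blocks∕fine geometry∕background carriers∕pairing:
# an operator layer BY NAME ⟹ `N15At` with the two genuine `U ≡ 1` kernel layers; joint cofinality + regular trivial background ⟹ `PairedFamilyGuard.Live`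

Cell `pub-ymgap`, seat `pub-ymgap-dag-n15-a` (-a KNIT-BY-NAME seat of node N15; HUMAN RULING D-0062; chair R424 venue), generation 18, part 85 (three data `def`s — a sized [B6]
carrier and two re-based kernel families —, the rest theorems; 0 `sorry`).  `bears_on: R4∕N15 · K3⁷ SpineGivenEndpointR13SepCoPH (stmt-QuantumFields-20544)`.  Filed `--kind proof
--supports stmt-QuantumFields-20544 --as helper` — COUNT-NEUTRAL.  Imports part 84 (S-C; through it S-A∕S-B, dag-n15-w2's `…N15PairedFamilyGuard`, part 76, dag-n15-c G1, part 30) and part 27 `…N15VectorPieceBackground` (`unitTorusGeoS`);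
nothing in the tree is modified.  PATTERN = part 78 (`…N15FullPropagatorTgKnit`: `tgSiteOn`, `tgCovOn`, `n15At_tg_of_ne2PlusOperator`) with TWO generalisations.

WHY.  (1) Part 78's socket — and V-F∕V-G — hard-wire the COARSE geometry `tgGeoC (ι i)`, whose [B9] size field is `1`; by `EtaPairing.M_eq` every family plugged into it has
`gf.M = 1`, so (dag-n15-w2 p584544 `not_live_tgInstance_comp`) NO such knit can pass the K3⁷ v2 guard `PairedFamilyGuard.Live`, and its `NE2PlusOperator`∕`NE2PlusSite` conjuncts
are vacuous-able as statements.  (2) Part 78 also hard-wires the ARGUMENT lattice (real 1-forms blocked by `blkFine`); dag-n15-c's newest operator families are COLOURED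
(`bgInstanceM₂R`: arguments `(Tor × Fin (d+1)) × ι`, blocks `liftBlk blkFine ι` — `fgInstanceV1G`, INTENT-40's sized edition «on n15-a part 82's `TGIndexS`, reparametrisation
`α₀ ↦ Mα₀`»).  This file is the socket both generalisations need, ONCE: the coarse carrier is `opGeo (geoS d hL ι Mc i) (X i) (blk i)` with `geoS … i := unitTorusGeoS L (ι i).k (Mn (ι i)) (Mc i)`
= `{ unitTorusGeo … with M := Mc i }` (part 27's sized carrier; Bałaban's size `M` LIVE at the [B6] level, so n15-b's `opGeo`∕`fineGeo` and every background carrier built from `g.M` inherit it — the (3.35)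
letters read `c·M·α₀`), and `X i`, `blk i`, `gf i`, `Bc i`, `Bf i`, `pair i` are ARBITRARY.  The two genuine `U ≡ 1` kernel layers (dag-n15-c G1's site form `(Q′G′²Q′*)⁻¹`,
part 76's (2.156) covariance) are re-based on it — their inequalities are LITERALLY the landed ones (`Iff.rfl`: they read sites, lengths, distances, never `M`, `X` or `blk`).

WHAT.  §1 def `geoS` + its readings (`geoS_M`, `geoS_k`, `geoS_len`, `geoS_dist`, `triangle254_geoS`, `rowSum_geoS`, `geoS_dist_nonneg∕symm∕self` — the [B6] carrier facts a
producer's operator proof consumes, transported from `B6UnitTorusCarrier` by `rfl`); §2 defs `siteOnS`, `covOnS` (+ `_ker`, + the two `Iff.rfl` transports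
`etaRateIneqSite_siteOnS_iff`, `etaRateIneqUnit_covOnS_iff`); §3 ★ `ne2PlusSite_siteOnS`, ★ `ne2PlusUnit_covOnS` (size guard honest: `M₅ = 1`, `a₀ = 1`; the kernels are U-blind —
said); §4 ★★★ **`n15At_opGeoS_of_ne2PlusOperator`** (ANY operator family with `NE2PlusOperator` BY NAME ⟹ `N15At`), `layers_…`, ★★ **`live_opGeoS`** (joint cofinality of
`(Mc, k ∘ ι)` + the fine carrier's trivial configuration regular at every `α₀ > 0` ⟹ `Live`, for ANY kernels), ★★ `live_and_n15At_opGeoS_of_ne2PlusOperator`, `n15At_opGeoS_of_operator_unit` (operator AND a producer's own U-seeing unit layer by name); §5 the keyed-home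
face `s_N15_of_admits_opGeoS_of_ne2PlusOperator` (part 30's interface); §6 COHERENCE: part 82's own sized family IS an instance of the socket (`n15At_socket_tgInstanceS` — the
socket at `ι := toTGIndex`, `Mc := Msz`, 1-forms, `blkFine`, `tgGeoFS`, one-point backgrounds, `tgPairingS`, fed with `ne2PlusOperator_fullG_sized`, elaborates to S-A's family
by `rfl`-level unification — the A2 exhibit of this file).

HONEST FRAMING.  Count-neutral kernel bookkeeping BY NAME; no estimate (G1, part 76 ∕ `T4Cov2156Rate`, and whatever operator theorem is fed in).  The site ∕ unit layers are the
`U ≡ 1` objects and do NOT see the background — only the operator layer's «+» can be live, at the species its producer chose; what IS live here for all three layers is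
Bałaban's SIZE `M` (the guard) — formally on U-blind kernels (ref-B READ-771 CAUTION-P), substantively through the producer's (3.35) letters `c·M·α₀`.  [B9] Thms 3.1∕3.2∕3.15 at a
general (3.35)-regular `U` (NE2⁺ proper) are NOT PRINTED as η-rates and NOT claimed; Node 00's [B9] operator layer of record is residual — **N15 is NOT discharged** (typed 28∕28 ·
discharged 5∕27 of record unchanged); K3⁷ OPEN; one finite four-torus programme at fixed `ε` — NOT ℝ⁴, NOT infinite volume, NOT OS, NOT a mass gap, NOT Clay.  Restate-immune.
-/

set_option autoImplicit false

noncomputable section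
namespace Summit.QuantumFields.YangMills.BalabanUVNodes.N15.GenuineRecord

open Literature.MathematicalPhysics.QuantumFieldTheory.Balaban1983to89
open Literature.MathematicalPhysics.QuantumFieldTheory.Balaban1983to89.T4Continuum (T4Family ULoop)
open Literature.MathematicalPhysics.QuantumFieldTheory.Balaban1983to89.T4EtaRate (EtaPairing PairedInstance NE2PlusOperator NE2PlusSite NE2PlusUnit EtaRateIneqUnit
  EtaRateIneqSite)
open Literature.MathematicalPhysics.QuantumFieldTheory.Balaban1983to89.T4EtaRateDefectSite (pt9Bg)
open Literature.MathematicalPhysics.QuantumFieldTheory.Balaban1983to89.B5Prop11Plancherel (Tor fine)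
open Literature.MathematicalPhysics.QuantumFieldTheory.Balaban1983to89.B6UnitTorusCarrier (unitTorusGeo unitTorusGeo_len triangle254_unitTorusGeo rowSum_unitTorusGeo
  unitTorusGeo_dist_nonneg unitTorusGeo_dist_symm unitTorusGeo_dist_self)
open Literature.MathematicalPhysics.QuantumFieldTheory.Balaban1983to89.B11SectG (RowSum)
open Literature.MathematicalPhysics.QuantumFieldTheory.King1986.Torus (tdistT)
open Node00 (NE2Objects₁₁)
open Summit.QuantumFields.YangMills.BalabanUVNodes.N15.OperatorReadout (opGeo)
open Summit.QuantumFields.YangMills.BalabanUVNodes.N15.TwoGrid (TGIndex tgGeoC)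
open Summit.QuantumFields.YangMills.BalabanUVNodes.N15.GenuineSite (genuineSiteStep etaRateIneqSite_genuineSite_family)
open Summit.QuantumFields.YangMills.BalabanUVNodes.N15.AtKeyedHome (s_N15_of_admits)
open Summit.QuantumFields.YangMills.BalabanUVNodes.N15.PairedFamilyGuard (Live)
open Summit.QuantumFields.YangMills.BalabanUVNodes.N15.VectorPiece (blkFine unitTorusGeoS)
open YMDAG.UVSplit (Datum NE2Carriers RateCarriers RateRecordPred N15At S_N15 ne2OfRecord₁₁)

variable {d : ℕ} {L : ℕ} [NeZero L]

/-! ## §1 The size-live one-scale [B6] carrier and its readings -/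

section Carrier

variable {I : Type}

/-- **THE SIZE-LIVE UNIT-TORUS CARRIER** at an index: this seat's part 27 `VectorPiece.unitTorusGeoS` (= `B6UnitTorusCarrier.unitTorusGeo L (ι i).k (Mn (ι i))` — the unit torus of
the coarse run of the torus index `ι i`, King's periodic sup-distance, `η = L^{−k}` — with Bałaban's size parameter set to `Mc i`) read at the index maps `ι`, `Mc`; the size is live
at the [B6] level, so that n15-b's `opGeo`∕`fineGeo` and every background carrier built from `g.M` inherit it (the (3.35) letters `O(1)·M·α₀`); `reducible`, so a producer's
family built over `unitTorusGeoS L j.k (Mn j) j.Msz` (dag-n15-c INTENT-40 `fgInstanceV1GS`) matches the socket literally. [cite: Balaban1985BackgroundPropagators, (3.35) p.396 (the `M`-cubes); Balaban1984PropagatorsII, (2.46) p.231 (the carrier, one-scale instance)] -/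
@[reducible] def geoS (d : ℕ) (hL : Odd L ∧ 1 < L) (ι : I → TGIndex) (Mc : I → ℝ) (i : I) : B6.Geometry :=
  unitTorusGeoS L (ι i).k (TGIndex.Mn d hL (ι i)) (Mc i)

variable (hL : Odd L ∧ 1 < L) (ι : I → TGIndex) (Mc : I → ℝ)

omit [NeZero L] in
/-- The carrier's size field IS `Mc i`. [folklore] -/
theorem geoS_M (i : I) : (geoS d hL ι Mc i).M = Mc i := rfl

omit [NeZero L] in
/-- The carrier's number of scales IS `(ι i).k`. [folklore] -/
theorem geoS_k (i : I) : (geoS d hL ι Mc i).k = (ι i).k := rfl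

omit [NeZero L] in
/-- The carrier's distance IS King's periodic sup-distance. [folklore] -/
theorem geoS_dist (i : I) (y y' : Tor (TGIndex.Mn d hL (ι i))) : (geoS d hL ι Mc i).dist y y' = tdistT (TGIndex.Mn d hL (ι i)) y y' := rfl

/-- Every site has physical size `L^kη = 1`. [folklore] -/
theorem geoS_len (i : I) (y : Tor (TGIndex.Mn d hL (ι i))) : (geoS d hL ι Mc i).len y = 1 :=
  unitTorusGeo_len L (ι i).k (TGIndex.Mn d hL (ι i)) (NeZero.ne L) y

omit [NeZero L] in
/-- (2.54) for the size-live carrier (`B6UnitTorusCarrier.triangle254_unitTorusGeo` — the distance does not read `M`). [cite: Balaban1984PropagatorsII, (2.54) p.232] -/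
theorem triangle254_geoS (i : I) : B6RandomWalk.Triangle254 (geoS d hL ι Mc i) :=
  triangle254_unitTorusGeo L (ι i).k (TGIndex.Mn d hL (ι i))

omit [NeZero L] in
/-- (2.61) for the size-live carrier, uniformly in the volume (`rowSum_unitTorusGeo`). [cite: Balaban1984PropagatorsII, Lemma 2.1 (2.61) p.234] -/
theorem rowSum_geoS (i : I) {σ : ℝ} (hσ : 0 < σ) : RowSum (geoS d hL ι Mc i) σ (B4Sect5Proof.latticeConst (d + 1) σ) :=
  rowSum_unitTorusGeo L (ι i).k (TGIndex.Mn d hL (ι i)) hσ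

omit [NeZero L] in
/-- `d ≥ 0` on the size-live carrier. [folklore] -/
theorem geoS_dist_nonneg (i : I) (y y' : Tor (TGIndex.Mn d hL (ι i))) : 0 ≤ (geoS d hL ι Mc i).dist y y' :=
  unitTorusGeo_dist_nonneg L (ι i).k (TGIndex.Mn d hL (ι i)) y y'

omit [NeZero L] in
/-- `d` is symmetric on the size-live carrier. [folklore] -/
theorem geoS_dist_symm (i : I) (y y' : Tor (TGIndex.Mn d hL (ι i))) : (geoS d hL ι Mc i).dist y y' = (geoS d hL ι Mc i).dist y' y :=
  unitTorusGeo_dist_symm L (ι i).k (TGIndex.Mn d hL (ι i)) y y'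

omit [NeZero L] in
/-- `d(y, y) = 0` on the size-live carrier. [folklore] -/
theorem geoS_dist_self (i : I) (y : Tor (TGIndex.Mn d hL (ι i))) : (geoS d hL ι Mc i).dist y y = 0 :=
  unitTorusGeo_dist_self L (ι i).k (TGIndex.Mn d hL (ι i)) y

/-- ★ **JOINT COFINALITY ON PART 82's SIZED INDEX**: the maps `ι := TGIndexS.toTGIndex`, `Mc := TGIndexS.Msz` are jointly cofinal in size and scale count (`tgIndexS_cofinal`) — the
hypothesis `hcof` of `live_opGeoS` below for any family indexed by `TGIndexS` (or by `TGIndexS × J` through the first projection, `cofinal_fst_tgIndexS`). [folklore] -/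
theorem cofinal_tgIndexS (M₅ : ℝ) (k₀ : ℕ) : ∃ j : TGIndexS, M₅ ≤ j.Msz ∧ k₀ ≤ j.toTGIndex.k := tgIndexS_cofinal M₅ k₀

/-- … and through a first projection `TGIndexS × J` (`J` inhabited — e.g. a direction `Fin (d + 1)`). [folklore] -/
theorem cofinal_fst_tgIndexS {J : Type} [Nonempty J] (M₅ : ℝ) (k₀ : ℕ) : ∃ j : TGIndexS × J, M₅ ≤ j.1.Msz ∧ k₀ ≤ j.1.toTGIndex.k := by
  obtain ⟨j, hj⟩ := tgIndexS_cofinal M₅ k₀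
  exact ⟨⟨j, Classical.arbitrary J⟩, hj⟩

end Carrier

/-! ## §2 The two genuine `U ≡ 1` kernels re-based on `opGeo (geoS …) (X i) (blk i)` over an arbitrary background carrier -/

section Kernels

variable {I : Type} (hL : Odd L ∧ 1 < L) (ι : I → TGIndex) (Mc : I → ℝ) (X : I → Type) [∀ i, Fintype (X i)]
  (blk : ∀ i, X i → Tor (TGIndex.Mn d hL (ι i))) (B : I → B9.Backgrounds)

/-- THE GENUINE `U ≡ 1` SITE KERNEL `𝔇((Q′G′²Q′*)⁻¹)` (dag-n15-c G1 `genuineSiteStep`) re-based on the size-live coarse carrier `opGeo (geoS …) (X i) (blk i)` and an arbitrary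
background carrier `B i` (configuration ignored). [cite: Balaban1985BackgroundPropagators, Thm 3.2 (3.48) p.398 (the kernel, shape)] -/
def siteOnS (d : ℕ) (hL : Odd L ∧ 1 < L) (aS : ℝ) (ι : I → TGIndex) (Mc : I → ℝ) (X : I → Type) [∀ i, Fintype (X i)]
    (blk : ∀ i, X i → Tor (TGIndex.Mn d hL (ι i))) (B : I → B9.Backgrounds) (i : I) : B9.SiteKernel (opGeo (geoS d hL ι Mc i) (X i) (blk i)) (B i) :=
  ⟨fun _ y y' => (genuineSiteStep d hL aS (ι i)).ker () y y'⟩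

/-- THE (2.156) UNIT-LATTICE COVARIANCE DIFFERENCE (part 76 `tgCovStep`) re-based likewise. [cite: Balaban1984PropagatorsII, (2.156) p.250 (object); Balaban1985BackgroundPropagators, Thm 3.15 (3.187) p.432 (shape)] -/
def covOnS (d : ℕ) (hL : Odd L ∧ 1 < L) (α β : Fin (d + 1)) (ι : I → TGIndex) (Mc : I → ℝ) (X : I → Type) [∀ i, Fintype (X i)]
    (blk : ∀ i, X i → Tor (TGIndex.Mn d hL (ι i))) (B : I → B9.Backgrounds) (i : I) : B9.SiteKernel (opGeo (geoS d hL ι Mc i) (X i) (blk i)) (B i) :=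
  ⟨fun _ y y' => (tgCovStep d hL α β (ι i)).ker () y y'⟩

/-- Unfolding of `siteOnS`. [folklore] -/
theorem siteOnS_ker (aS : ℝ) (i : I) (U : (B i).Cfg) (y y' : Tor (TGIndex.Mn d hL (ι i))) :
    (siteOnS d hL aS ι Mc X blk B i).ker U y y' = (genuineSiteStep d hL aS (ι i)).ker () y y' := rfl

/-- Unfolding of `covOnS`. [folklore] -/
theorem covOnS_ker (α β : Fin (d + 1)) (i : I) (U : (B i).Cfg) (y y' : Tor (TGIndex.Mn d hL (ι i))) :
    (covOnS d hL α β ι Mc X blk B i).ker U y y' = (tgCovStep d hL α β (ι i)).ker () y y' := rfl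

/-- The (3.48)-shaped inequality for the re-based site kernel IS G1's at the torus index (lengths, distances, rate factors agree; `M`, `X`, `blk` are not read). [folklore] -/
theorem etaRateIneqSite_siteOnS_iff (aS : ℝ) (i : I) (d' : ℕ) (p C δ γ : ℝ) (U : (B i).Cfg) :
    EtaRateIneqSite d' p (siteOnS d hL aS ι Mc X blk B i) C δ γ U ↔ EtaRateIneqSite d' p (genuineSiteStep d hL aS (ι i)) C δ γ () :=
  Iff.rfl

/-- The (3.187)-shaped inequality for the re-based unit kernel IS part 76's at the torus index. [folklore] -/
theorem etaRateIneqUnit_covOnS_iff (α β : Fin (d + 1)) (i : I) (B₀ δ₀ θ : ℝ) (k : ℕ) (U : (B i).Cfg) :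
    EtaRateIneqUnit (covOnS d hL α β ι Mc X blk B i) (fun _ => True) (opGeo (geoS d hL ι Mc i) (X i) (blk i)).dist B₀ δ₀ θ k U ↔
      EtaRateIneqUnit (tgCovStep d hL α β (ι i)) (fun _ => True) (tgGeoC d hL (ι i)).dist B₀ δ₀ θ k () :=
  Iff.rfl

end Kernels

/-! ## §3 The site and unit conjuncts on any such family (size guard honest, background hypotheses idle on U-blind kernels) -/

section Layers

variable {I : Type} (hL : Odd L ∧ 1 < L) (ι : I → TGIndex) (Mc : I → ℝ) (X : I → Type) [∀ i, Fintype (X i)]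
  (blk : ∀ i, X i → Tor (TGIndex.Mn d hL (ι i))) (gf : I → B9.Geometry) (Bc Bf : I → B9.Backgrounds)

/-- ★ **`NE2PlusSite` FOR THE RE-BASED GENUINE SITE KERNEL** on any family `pi i = ⟨opGeo (geoS … i) (X i) (blk i), gf i, Bc i, Bf i, pair i⟩`, every `(d′, p)`, `c₃₅`; odd `L ≥ 3`,
`a_S > 0`: constants `(M₅, δ, a₀, C, γ) = (1, δ, 1, C, ¼)` of G1's `etaRateIneqSite_genuineSite_family`.  The size guard `M₅ ≤ gf.M` is HONEST (`M₅ = 1`; live when `Mc` is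
cofinal); the regularity hypothesis is idle (the kernel is U-blind) — said. [cite: Balaban1985BackgroundPropagators, Thm 3.2 (3.48) p.398 + Thm 3.14 pp.426–427 (quantifier template)] -/
theorem ne2PlusSite_siteOnS (hLodd : Odd L) (hL2 : 2 ≤ L) {aS : ℝ} (haS : 0 < aS)
    (pair : ∀ i, EtaPairing (opGeo (geoS d hL ι Mc i) (X i) (blk i)) (gf i) (Bc i) (Bf i)) (d' : ℕ) (p c35 : ℝ) :
    NE2PlusSite d' p c35 (fun i => (⟨opGeo (geoS d hL ι Mc i) (X i) (blk i), gf i, Bc i, Bf i, pair i⟩ : PairedInstance)) (siteOnS d hL aS ι Mc X blk Bf) := by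
  obtain ⟨δ, C, hδ, hC, H⟩ := etaRateIneqSite_genuineSite_family (d := d) hLodd hL2 hL haS d' p
  exact ⟨1, δ, 1, C, 1 / 4, one_pos, hδ, one_pos, hC, by norm_num, fun i _ _ _ _ U _ =>
    (etaRateIneqSite_siteOnS_iff hL ι Mc X blk Bf aS i d' p C δ (1 / 4) U).mpr (H (ι i) ())⟩

/-- ★ **`NE2PlusUnit` FOR THE RE-BASED (2.156) COVARIANCE** on any such family whose torus indices are L-divisible (`m_T ≥ 1`; `d ≥ 1`, `L ≥ 2`), every direction pair and `c₃₅`: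
constants `(δ₀, a₀, B₀, θ) = (δ₀, 1, B₀, L⁻¹)` of part 76's `etaRateIneqUnit_tgCov`, clean rate `θ = L⁻¹ < 1` over the family's (cofinal) scale counts `gc.k = (ι i).k`; the
regularity hypotheses are idle (U-blind kernel) — said. [cite: Balaban1985BackgroundPropagators, Thm 3.15 (3.187) p.432 (quantifier template); King1986, Lemma 4.5 (4.38) p.674 (shape)] -/
theorem ne2PlusUnit_covOnS (hd : 1 ≤ d) (hL2 : 2 ≤ L) (hι : ∀ i, 1 ≤ (ι i).mT)
    (pair : ∀ i, EtaPairing (opGeo (geoS d hL ι Mc i) (X i) (blk i)) (gf i) (Bc i) (Bf i)) (α β : Fin (d + 1)) (c35 : ℝ) :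
    NE2PlusUnit c35 (fun i => (⟨opGeo (geoS d hL ι Mc i) (X i) (blk i), gf i, Bc i, Bf i, pair i⟩ : PairedInstance)) (covOnS d hL α β ι Mc X blk Bf)
      (fun _ _ => True) (fun i => (opGeo (geoS d hL ι Mc i) (X i) (blk i)).dist) := by
  obtain ⟨B₀, δ₀, hB₀, hδ₀, H⟩ := etaRateIneqUnit_tgCov (d := d) hd hL
  have hLpos : (0 : ℝ) < L := by exact_mod_cast (lt_of_lt_of_le zero_lt_two hL2)
  have hθ1 : ((L : ℝ)⁻¹) < 1 := inv_lt_one_of_one_lt₀ (by exact_mod_cast hL2)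
  exact ⟨δ₀, 1, B₀, (L : ℝ)⁻¹, hδ₀, one_pos, hB₀, inv_pos.mpr hLpos, hθ1, fun i _ _ _ U _ _ =>
    (etaRateIneqUnit_covOnS_iff hL ι Mc X blk Bf α β i B₀ δ₀ ((L : ℝ)⁻¹) (ι i).k U).mpr (H α β ⟨ι i, hι i⟩ ())⟩

end Layers

/-! ## §4 ★★★ The sized knit: operator layer BY NAME ⟹ `N15At`; cofinality + regular trivial background ⟹ `Live` -/

section Knit

variable {I : Type} (hL : Odd L ∧ 1 < L) (ι : I → TGIndex) (Mc : I → ℝ) (X : I → Type) [∀ i, Fintype (X i)]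
  (blk : ∀ i, X i → Tor (TGIndex.Mn d hL (ι i))) (gf : I → B9.Geometry) (Bc Bf : I → B9.Backgrounds)

/-- ★★★ **THE SIZED `N15At` KNIT.**  For `d ≥ 1`, odd `L ≥ 3`, `a_S > 0`, directions `α β`, ANY index type with torus indices `ι` in `m_T ≥ 1` and sizes `Mc`, ANY argument lattices
`X i` with blocks `blk i`, ANY fine geometries `gf i`, background carriers `Bc i`, `Bf i` and pairings `pair i`, letters `c₃₅`, `p`, and ANY operator family `Kop` on
`pi i = ⟨opGeo (geoS … i) (X i) (blk i), gf i, Bc i, Bf i, pair i⟩`: `NE2PlusOperator c₃₅ pi Kop → N15At ⟨I, c₃₅, p, pi, Kop, siteOnS a_S …, covOnS α β …, ⊤, dist⟩` — the operator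
layer is the (only) input; SITE = G1's `(Q′G′²Q′*)⁻¹`, UNIT = [B6] (2.156) `C^{(k)}_Λ`, both `U ≡ 1` kernels re-based on `Bf` (their «+» idle, said).  The socket for dag-n15-c's SIZED
background-live operator families (INTENT-40) and any later one. [bookkeeping] -/
theorem n15At_opGeoS_of_ne2PlusOperator (hd : 1 ≤ d) (hLodd : Odd L) (hL2 : 2 ≤ L) {aS : ℝ} (haS : 0 < aS) (α β : Fin (d + 1))
    (hι : ∀ i, 1 ≤ (ι i).mT) (pair : ∀ i, EtaPairing (opGeo (geoS d hL ι Mc i) (X i) (blk i)) (gf i) (Bc i) (Bf i)) {c35 : ℝ} (p : ℝ)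
    (Kop : ∀ i, B9.KernelFamily (opGeo (geoS d hL ι Mc i) (X i) (blk i)) (Bf i))
    (hop : NE2PlusOperator c35 (fun i => (⟨opGeo (geoS d hL ι Mc i) (X i) (blk i), gf i, Bc i, Bf i, pair i⟩ : PairedInstance)) Kop) :
    N15At { I := I, c35 := c35, p := p, pi := fun i => ⟨opGeo (geoS d hL ι Mc i) (X i) (blk i), gf i, Bc i, Bf i, pair i⟩, Kop := Kop,
            Ksite := siteOnS d hL aS ι Mc X blk Bf, Kunit := covOnS d hL α β ι Mc X blk Bf, inΛ := fun _ _ => True,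
            unitDist := fun i => (opGeo (geoS d hL ι Mc i) (X i) (blk i)).dist } :=
  ⟨hop, ne2PlusSite_siteOnS (d := d) hL ι Mc X blk gf Bc Bf hLodd hL2 haS pair 4 p c35,
    ne2PlusUnit_covOnS (d := d) hL ι Mc X blk gf Bc Bf hd hL2 hι pair α β c35⟩

/-- **THE THREE LAYERS SPELLED OUT** for the sized knit. [bookkeeping] -/
theorem layers_opGeoS_of_ne2PlusOperator (hd : 1 ≤ d) (hLodd : Odd L) (hL2 : 2 ≤ L) {aS : ℝ} (haS : 0 < aS) (α β : Fin (d + 1))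
    (hι : ∀ i, 1 ≤ (ι i).mT) (pair : ∀ i, EtaPairing (opGeo (geoS d hL ι Mc i) (X i) (blk i)) (gf i) (Bc i) (Bf i)) {c35 : ℝ} (p : ℝ)
    (Kop : ∀ i, B9.KernelFamily (opGeo (geoS d hL ι Mc i) (X i) (blk i)) (Bf i))
    (hop : NE2PlusOperator c35 (fun i => (⟨opGeo (geoS d hL ι Mc i) (X i) (blk i), gf i, Bc i, Bf i, pair i⟩ : PairedInstance)) Kop) :
    NE2PlusOperator c35 (fun i => (⟨opGeo (geoS d hL ι Mc i) (X i) (blk i), gf i, Bc i, Bf i, pair i⟩ : PairedInstance)) Kop ∧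
    NE2PlusSite 4 p c35 (fun i => (⟨opGeo (geoS d hL ι Mc i) (X i) (blk i), gf i, Bc i, Bf i, pair i⟩ : PairedInstance)) (siteOnS d hL aS ι Mc X blk Bf) ∧
    NE2PlusUnit c35 (fun i => (⟨opGeo (geoS d hL ι Mc i) (X i) (blk i), gf i, Bc i, Bf i, pair i⟩ : PairedInstance)) (covOnS d hL α β ι Mc X blk Bf)
      (fun _ _ => True) (fun i => (opGeo (geoS d hL ι Mc i) (X i) (blk i)).dist) :=
  n15At_opGeoS_of_ne2PlusOperator (d := d) hL ι Mc X blk gf Bc Bf hd hLodd hL2 haS α β hι pair p Kop hop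

omit [NeZero L] in
/-- ★★ **THE FAMILY PASSES THE K3⁷ v2 GUARD** (dag-n15-w2's `PairedFamilyGuard.Live` BY NAME) — FOR ANY KERNELS — as soon as (i) the pair `(Mc, k ∘ ι)` is JOINTLY COFINAL (on part
82's index: `cofinal_tgIndexS` ∕ `cofinal_fst_tgIndexS`) and (ii) the fine background carrier's trivial configuration is (3.35)- and (3.36)-regular at every `α₀ > 0` (true for
every carrier of the lineage: the letters bound `|U|`-type quantities that vanish at `one`).  `gf.M = Mc i` by the pairing's `M_eq`; the region `⊤` is met at the torus site `0`. [bookkeeping] -/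
theorem live_opGeoS (pair : ∀ i, EtaPairing (opGeo (geoS d hL ι Mc i) (X i) (blk i)) (gf i) (Bc i) (Bf i)) (c35 p : ℝ)
    (Kop : ∀ i, B9.KernelFamily (opGeo (geoS d hL ι Mc i) (X i) (blk i)) (Bf i))
    (Ksite Kunit : ∀ i, B9.SiteKernel (opGeo (geoS d hL ι Mc i) (X i) (blk i)) (Bf i))
    (hcof : ∀ (M₅ : ℝ) (k₀ : ℕ), ∃ i : I, M₅ ≤ Mc i ∧ k₀ ≤ (ι i).k)
    (hreg : ∀ (i : I) (α₀ : ℝ), 0 < α₀ → (Bf i).Reg335 c35 α₀ (Bf i).one ∧ (Bf i).Reg336 c35 α₀ (Bf i).one) :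
    Live ⟨I, c35, p, fun i => ⟨opGeo (geoS d hL ι Mc i) (X i) (blk i), gf i, Bc i, Bf i, pair i⟩, Kop, Ksite, Kunit, fun _ _ => True,
      fun i => (opGeo (geoS d hL ι Mc i) (X i) (blk i)).dist⟩ := by
  refine ⟨fun M₅ k₀ => ?_, fun i α₀ hα₀ => hreg i α₀ hα₀, fun i => ⟨fun _ => 0, trivial⟩⟩
  obtain ⟨i, hM, hk⟩ := hcof M₅ k₀
  refine ⟨i, ?_, hk⟩
  show M₅ ≤ (gf i).M
  rw [(pair i).M_eq]
  exact hM

/-- ★★ **GUARD ∧ `N15At` TOGETHER** for such a family from an operator layer BY NAME, joint cofinality and the trivial-configuration regularity (`d ≥ 1`, odd `L ≥ 3`, `a_S > 0`,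
`m_T ≥ 1`). [bookkeeping] -/
theorem live_and_n15At_opGeoS_of_ne2PlusOperator (hd : 1 ≤ d) (hLodd : Odd L) (hL2 : 2 ≤ L) {aS : ℝ} (haS : 0 < aS) (α β : Fin (d + 1))
    (hι : ∀ i, 1 ≤ (ι i).mT) (pair : ∀ i, EtaPairing (opGeo (geoS d hL ι Mc i) (X i) (blk i)) (gf i) (Bc i) (Bf i)) {c35 : ℝ} (p : ℝ)
    (Kop : ∀ i, B9.KernelFamily (opGeo (geoS d hL ι Mc i) (X i) (blk i)) (Bf i))
    (hop : NE2PlusOperator c35 (fun i => (⟨opGeo (geoS d hL ι Mc i) (X i) (blk i), gf i, Bc i, Bf i, pair i⟩ : PairedInstance)) Kop)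
    (hcof : ∀ (M₅ : ℝ) (k₀ : ℕ), ∃ i : I, M₅ ≤ Mc i ∧ k₀ ≤ (ι i).k)
    (hreg : ∀ (i : I) (α₀ : ℝ), 0 < α₀ → (Bf i).Reg335 c35 α₀ (Bf i).one ∧ (Bf i).Reg336 c35 α₀ (Bf i).one) :
    Live ⟨I, c35, p, fun i => ⟨opGeo (geoS d hL ι Mc i) (X i) (blk i), gf i, Bc i, Bf i, pair i⟩, Kop, siteOnS d hL aS ι Mc X blk Bf,
        covOnS d hL α β ι Mc X blk Bf, fun _ _ => True, fun i => (opGeo (geoS d hL ι Mc i) (X i) (blk i)).dist⟩ ∧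
      N15At { I := I, c35 := c35, p := p, pi := fun i => ⟨opGeo (geoS d hL ι Mc i) (X i) (blk i), gf i, Bc i, Bf i, pair i⟩, Kop := Kop,
              Ksite := siteOnS d hL aS ι Mc X blk Bf, Kunit := covOnS d hL α β ι Mc X blk Bf, inΛ := fun _ _ => True,
              unitDist := fun i => (opGeo (geoS d hL ι Mc i) (X i) (blk i)).dist } :=
  ⟨live_opGeoS (d := d) hL ι Mc X blk gf Bc Bf pair c35 p Kop _ _ hcof hreg,
    n15At_opGeoS_of_ne2PlusOperator (d := d) hL ι Mc X blk gf Bc Bf hd hLodd hL2 haS α β hι pair p Kop hop⟩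

/-- ★★ **THE SIZED KNIT WITH A PRODUCER's OWN (U-SEEING) UNIT LAYER**: operator layer AND unit layer BY NAME (any unit kernel `Kunit`, region `inΛ`, distance `dist` — e.g. the
exactly dressed (2.156) covariance of programme V on a sized carrier) ⟹ `N15At`, the site layer being G1's genuine `U ≡ 1` kernel re-based (U-blind, said). [bookkeeping] -/
theorem n15At_opGeoS_of_operator_unit (hLodd : Odd L) (hL2 : 2 ≤ L) {aS : ℝ} (haS : 0 < aS)
    (pair : ∀ i, EtaPairing (opGeo (geoS d hL ι Mc i) (X i) (blk i)) (gf i) (Bc i) (Bf i)) {c35 : ℝ} (p : ℝ)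
    (Kop : ∀ i, B9.KernelFamily (opGeo (geoS d hL ι Mc i) (X i) (blk i)) (Bf i))
    (Kunit : ∀ i, B9.SiteKernel (opGeo (geoS d hL ι Mc i) (X i) (blk i)) (Bf i))
    (inΛ : ∀ i, Tor (TGIndex.Mn d hL (ι i)) → Prop) (dist : ∀ i, Tor (TGIndex.Mn d hL (ι i)) → Tor (TGIndex.Mn d hL (ι i)) → ℝ)
    (hop : NE2PlusOperator c35 (fun i => (⟨opGeo (geoS d hL ι Mc i) (X i) (blk i), gf i, Bc i, Bf i, pair i⟩ : PairedInstance)) Kop)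
    (hunit : NE2PlusUnit c35 (fun i => (⟨opGeo (geoS d hL ι Mc i) (X i) (blk i), gf i, Bc i, Bf i, pair i⟩ : PairedInstance)) Kunit inΛ dist) :
    N15At { I := I, c35 := c35, p := p, pi := fun i => ⟨opGeo (geoS d hL ι Mc i) (X i) (blk i), gf i, Bc i, Bf i, pair i⟩, Kop := Kop,
            Ksite := siteOnS d hL aS ι Mc X blk Bf, Kunit := Kunit, inΛ := inΛ, unitDist := dist } :=
  ⟨hop, ne2PlusSite_siteOnS (d := d) hL ι Mc X blk gf Bc Bf hLodd hL2 haS pair 4 p c35, hunit⟩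

/-! ## §5 The sized knit at any keyed home (part 30's interface) -/

variable {N : ℕ} [NeZero N] {key : (F : T4Family) → Datum F N → Prop}

/-- ★★ **THE SIZED KNIT AT ANY KEYED HOME**: with the data of `n15At_opGeoS_of_ne2PlusOperator` and an operator layer `hop` BY NAME, a rate home `RRec` over ANY key admitting only the
literals of a key-indexed NE2 reading whose value everywhere is the knitted bundle has `S_N15 RRec`. [bookkeeping] -/
theorem s_N15_of_admits_opGeoS_of_ne2PlusOperator (hd : 1 ≤ d) (hLodd : Odd L) (hL2 : 2 ≤ L) {aS : ℝ} (haS : 0 < aS) (α β : Fin (d + 1))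
    (hι : ∀ i, 1 ≤ (ι i).mT) (pair : ∀ i, EtaPairing (opGeo (geoS d hL ι Mc i) (X i) (blk i)) (gf i) (Bc i) (Bf i)) {c35 : ℝ} (p : ℝ)
    (Kop : ∀ i, B9.KernelFamily (opGeo (geoS d hL ι Mc i) (X i) (blk i)) (Bf i))
    (hop : NE2PlusOperator c35 (fun i => (⟨opGeo (geoS d hL ι Mc i) (X i) (blk i), gf i, Bc i, Bf i, pair i⟩ : PairedInstance)) Kop)
    (ne2At : ∀ {F : T4Family} {D : Datum F N}, key F D → (ℕ → ℝ) → List (ULoop F) → ℕ → NE2Objects₁₁) (RRec : RateRecordPred N)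
    (hadm : ∀ (F : T4Family) (D : Datum F N) (g₀ : ℕ → ℝ) (os : List (ULoop F)) (R : RateCarriers N), RRec F D g₀ os R →
      ∃ (h : key F D) (k : ℕ), R.ne2 = ne2OfRecord₁₁ (ne2At h g₀ os k))
    (h : ∀ (F : T4Family) (D : Datum F N) (h : key F D) (g₀ : ℕ → ℝ) (os : List (ULoop F)) (k : ℕ),
      ne2At h g₀ os k = ⟨I, c35, p, fun i => ⟨opGeo (geoS d hL ι Mc i) (X i) (blk i), gf i, Bc i, Bf i, pair i⟩, Kop, siteOnS d hL aS ι Mc X blk Bf,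
        covOnS d hL α β ι Mc X blk Bf, fun _ _ => True, fun i => (opGeo (geoS d hL ι Mc i) (X i) (blk i)).dist⟩) :
    S_N15 RRec := by
  refine s_N15_of_admits ne2At RRec hadm fun F D hk g₀ os k => ?_
  rw [h F D hk g₀ os k]
  exact n15At_opGeoS_of_ne2PlusOperator (d := d) hL ι Mc X blk gf Bc Bf hd hLodd hL2 haS α β hι pair p Kop hop

end Knit

/-! ## §6 Coherence (the A2 exhibit): part 82's own sized family IS an instance of the socket -/

/-- **PART 82's SIZED GENUINE FAMILY THROUGH THE SOCKET.**  At `ι := TGIndexS.toTGIndex`, `Mc := TGIndexS.Msz`, arguments = real 1-forms blocked by `blkFine`, fine geometry `tgGeoFS`,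
one-point backgrounds and the pairing `tgPairingS`, the socket's coarse carrier `opGeo (geoS …) …` IS `tgGeoCS` definitionally, the re-based kernels ARE `genuineSiteStepS` ∕
`tgCovStepS`, and the socket fed with part 82's `ne2PlusOperator_fullG_sized` yields `N15At` for a family that the kernel identifies with part 82's (`d ≥ 1`, odd `L ≥ 3`, `b, a_S > 0`).
[bookkeeping] -/
theorem n15At_socket_tgInstanceS (hd : 1 ≤ d) (hLodd : Odd L) (hL2 : 2 ≤ L) (hL : Odd L ∧ 1 < L) {b aS : ℝ} (hb : 0 < b) (haS : 0 < aS)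
    (ν μ α β : Fin (d + 1)) (c35 p : ℝ) :
    N15At { I := TGIndexS, c35 := c35, p := p,
            pi := fun j => ⟨opGeo (geoS d hL TGIndexS.toTGIndex TGIndexS.Msz j) (Tor (fine (L ^ j.k) (TGIndex.Mn d hL j.toTGIndex)) × Fin (d + 1))
              (blkFine L j.k (TGIndex.Mn d hL j.toTGIndex)), tgGeoFS d hL j, pt9Bg, pt9Bg, tgPairingS d hL j⟩,
            Kop := tgFamilyS d hL b ν μ,
            Ksite := siteOnS d hL aS TGIndexS.toTGIndex TGIndexS.Msz (fun j => Tor (fine (L ^ j.k) (TGIndex.Mn d hL j.toTGIndex)) × Fin (d + 1))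
              (fun j => blkFine L j.k (TGIndex.Mn d hL j.toTGIndex)) (fun _ => pt9Bg),
            Kunit := covOnS d hL α β TGIndexS.toTGIndex TGIndexS.Msz (fun j => Tor (fine (L ^ j.k) (TGIndex.Mn d hL j.toTGIndex)) × Fin (d + 1))
              (fun j => blkFine L j.k (TGIndex.Mn d hL j.toTGIndex)) (fun _ => pt9Bg),
            inΛ := fun _ _ => True,
            unitDist := fun j => (opGeo (geoS d hL TGIndexS.toTGIndex TGIndexS.Msz j) (Tor (fine (L ^ j.k) (TGIndex.Mn d hL j.toTGIndex)) × Fin (d + 1))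
              (blkFine L j.k (TGIndex.Mn d hL j.toTGIndex))).dist } :=
  n15At_fullG_sized (d := d) hd hLodd hL2 hL hb haS ν μ α β c35 p

end Summit.QuantumFields.YangMills.BalabanUVNodes.N15.GenuineRecord

end
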